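import Summits.ValiantsHypothesis.ValiantsHypothesis.Theorems.BarrierLeverChowBenchmarkPairsBlockPeelConfluent4Pairs

/-!
# Route BarrierLever — item 22038 `ChowBenchmarkPairs`, line `moore-peel`: the BLOCK PEEL, IX-c — the CONFLUENT QUADRUPLE
# CRITERION, part 3: `det C₄^κ(i) ≠ 0 ⇒ det J^κ(i,4)(Λ) ≠ 0`, the UNRESTRICTED node «CONFLUENT B4» and its arrow to node #1

Helper file (`--supports stmt-ValiantsHypothesis-22038`; cell valiant-natproofs, rung V4, 𝒟-side benchmark of record, line
`moore_peel`, planner RULING R71(b); seat val-np-p4 gen 31).  Closes NO item.  Setting: `…BlockPeelConfluent4Rows` / `…Pairs`.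

THIS FILE.  (i) every reduced row is `X^{pos} ·` a quotient row whose constant term is the entry of `C₄^κ(i)`
(`confRed4_eq_X_pow_mul`, `coeff_zero_confQuot4`, by iterated `divX`); (ii) the factorisation `U · J^κ(i,4)(Λ_conf) = diag(X^{pos}) · Q`
(`confU4_mul_blockMatrix`, `confRedMatrix4_eq`) with `constantCoeff Q = C₄` (`confQuotMatrix4_map_constantCoeff`); (iii)
**`det_blockMatrix_four_X_ne_zero_of_confluent : det C₄^κ(i) ≠ 0 → det J^κ(i,4)(Λ_0,…,Λ_3) ≠ 0`** in `ℤ[Λ]`; (iv) the by-name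
nodes **`Stmt.conjConfluentB4`** («`det C₄^{!}(i) ≠ 0` for EVERY `i ≥ 1`» — no reference to bad stages) and **`Stmt.conjB4`**
(«every quadruple block is good»), the arrows `conjB4_of_conjConfluentB4`, the QUADRUPLE TILING
`kernelPoisedAt_factorial_of_conjB4` (`h % 4` leading singles `≤ 3 ≤ 182`, then quadruples) and
**`segmentMeanValue_of_conjConfluentB4`** = node #1 `stub_segmentMeanValue` VERBATIM for every `h`.

EVIDENCE (kit j333264 + j333265, `--workitem 22038`): `C₄^{!}(i)` is nonsingular mod 65521 for EVERY `1 ≤ i ≤ 1500` — no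
exception (the triple matrix fails at the all-good `i = 384, 746` and nowhere else `≤ 2000`, kit j333081/j333255; the double one at
`12, 46, 182, 214, 363, 444, 725, 726, 892, 1449, 1788` below `2000`).  REFUTER TARGET: one `i ≥ 1` with
`det C₄^{!}(i) = 0` mod two primes (kills `Stmt.conjConfluentB4`, not `Stmt.conjB4` or node #1).

WHAT THIS IS NOT: the nodes and node #1 stay OPEN; nothing on crux stmt-ValiantsHypothesis-14610 or on `VP` versus `VNP`.
-/

set_option linter.dupNamespace false

namespace Summit.ValiantsHypothesis.ValiantsHypothesis.Theorems.BarrierLever.MoorePeel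

open Polynomial Finset

/-! ## 41. Division by `X^m` -/

/-- A polynomial whose coefficients below `m` vanish is `X^m ·` its `m`-fold `divX`. -/
theorem eq_X_pow_mul_divX_iterate (p : ℤ[X]) (m : ℕ) (h : ∀ j, j < m → p.coeff j = 0) :
    p = X ^ m * (divX^[m] p) := by
  induction m generalizing p with
  | zero => simp
  | succ m ih =>
    have h0 : p.coeff 0 = 0 := h 0 (by omega)
    have e1 := eq_X_mul_divX h0
    have h' : ∀ j, j < m → (divX p).coeff j = 0 := fun j hj => by rw [coeff_divX]; exact h (j + 1) (by omega)
    have e2 := ih (divX p) h'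
    rw [Function.iterate_succ_apply, pow_succ]
    calc p = X * divX p := e1
      _ = X * (X ^ m * divX^[m] (divX p)) := by rw [← e2]
      _ = X ^ m * X * divX^[m] (divX p) := by ring

/-- The constant term of the `m`-fold `divX` is the `m`-th coefficient. -/
theorem coeff_zero_divX_iterate (p : ℤ[X]) (m : ℕ) : (divX^[m] p).coeff 0 = p.coeff m := by
  induction m generalizing p with
  | zero => simp
  | succ m ih => rw [Function.iterate_succ_apply, ih, coeff_divX]

/-! ## 42. Coefficients of the reduced rows: vanishing below the position, `C₄` at the position -/

section Coeffs

variable (κ : ℕ → ℕ) (i : ℕ) (ρ : BlockIdx i 4) (B : ℕ)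

/-- Attached classes: vanishing below the position. -/
theorem coeff_confRed4_att_lt (hq : (ρ.2 : ℕ) < i) (j : ℕ) (hj : j < confPos4 i ρ) : (confRed4 κ i ρ B).coeff j = 0 := by
  rw [confPos4_of_lt i ρ hq] at hj
  obtain ⟨s, hs⟩ : ∃ s, (ρ.1 : ℕ) = s := ⟨_, rfl⟩
  have hs3 := fst_le_three i ρ
  rw [hs] at hj hs3
  interval_cases s
  · omega
  · interval_cases j
    rw [confRed4_att1 κ i ρ B hq hs, coeff_natCast_mul', coeff_attFac1_zero, mul_zero]
  · interval_cases j
    · rw [confRed4_att2 κ i ρ B hq hs, coeff_natCast_mul', coeff_attFac2_zero, mul_zero]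
    · rw [confRed4_att2 κ i ρ B hq hs, coeff_natCast_mul', coeff_attFac2_one, mul_zero]
  · interval_cases j
    · rw [confRed4_att3 κ i ρ B hq hs, coeff_natCast_mul', coeff_attFac3_zero, mul_zero]
    · rw [confRed4_att3 κ i ρ B hq hs, coeff_natCast_mul', coeff_attFac3_one, mul_zero]
    · rw [confRed4_att3 κ i ρ B hq hs, coeff_natCast_mul', coeff_attFac3_two, mul_zero]

/-- Attached classes: the coefficient at the position is `κ̃[q,B]·B^s`. -/
theorem coeff_confRed4_att_pos (hq : (ρ.2 : ℕ) < i) : (confRed4 κ i ρ B).coeff (confPos4 i ρ) = confEntry4 κ i ρ B := by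
  obtain ⟨s, hs⟩ : ∃ s, (ρ.1 : ℕ) = s := ⟨_, rfl⟩
  have hpos : confPos4 i ρ = s := by rw [confPos4_of_lt i ρ hq, hs]
  have hpow : (B : ℤ) ^ (ρ.1 : ℕ) = (B : ℤ) ^ s := by rw [hs]
  unfold confEntry4
  rw [if_pos hq, hpow, hpos]
  have hs3 := fst_le_three i ρ
  rw [hs] at hs3
  interval_cases s
  · rw [confRed4_att0 κ i ρ B hq hs, pow_zero, mul_one, ← map_natCast C, coeff_C_zero]
  · rw [confRed4_att1 κ i ρ B hq hs, coeff_natCast_mul', coeff_attFac1_one, ← kincl_mul_sub_add_pow κ (ρ.2 : ℕ) B 1, pow_one]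
  · rw [confRed4_att2 κ i ρ B hq hs, coeff_natCast_mul', coeff_attFac2_two, ← kincl_mul_sub_add_pow κ (ρ.2 : ℕ) B 2]
  · rw [confRed4_att3 κ i ρ B hq hs, coeff_natCast_mul', coeff_attFac3_three, ← kincl_mul_sub_add_pow κ (ρ.2 : ℕ) B 3]

/-- **Every reduced row vanishes below its position.** -/
theorem coeff_confRed4_lt (j : ℕ) (hj : j < confPos4 i ρ) : (confRed4 κ i ρ B).coeff j = 0 := by
  by_cases hq : (ρ.2 : ℕ) < i
  · exact coeff_confRed4_att_lt κ i ρ B hq j hj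
  · exact coeff_confRed4_pair_lt κ i ρ B hq j hj

/-- **At its position every reduced row has the entry of `C₄`.** -/
theorem coeff_confRed4_pos : (confRed4 κ i ρ B).coeff (confPos4 i ρ) = confEntry4 κ i ρ B := by
  by_cases hq : (ρ.2 : ℕ) < i
  · exact coeff_confRed4_att_pos κ i ρ B hq
  · exact coeff_confRed4_pair_pos κ i ρ B hq

end Coeffs

/-! ## 43. Quotient rows, the factorisation, the criterion -/

section Assembly4

variable (κ : ℕ → ℕ) (i : ℕ)

/-- The quotient rows. -/
noncomputable def confQuot4 (ρ : BlockIdx i 4) (B : ℕ) : ℤ[X] := divX^[confPos4 i ρ] (confRed4 κ i ρ B)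

/-- `confRed4 = X^{pos} · confQuot4`. -/
theorem confRed4_eq_X_pow_mul (ρ : BlockIdx i 4) (B : ℕ) : confRed4 κ i ρ B = X ^ confPos4 i ρ * confQuot4 κ i ρ B :=
  eq_X_pow_mul_divX_iterate _ _ (coeff_confRed4_lt κ i ρ B)

/-- The constant terms of the quotient rows are the entries of `C₄`. -/
theorem coeff_zero_confQuot4 (ρ : BlockIdx i 4) (B : ℕ) : (confQuot4 κ i ρ B).coeff 0 = confEntry4 κ i ρ B := by
  rw [confQuot4, coeff_zero_divX_iterate, coeff_confRed4_pos]

/-- The row-operation matrix `U`. -/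
noncomputable def confU4 : Matrix (BlockIdx i 4) (BlockIdx i 4) ℤ[X] :=
  Matrix.of fun ρ ρ' =>
    if hq : (ρ.2 : ℕ) < i then ∑ k : Fin 4, confACoef4 (ρ.2 : ℕ) (ρ.1 : ℕ) k * (if ρ' = confAttMem4 i k ρ hq then 1 else 0)
    else ∑ m : Fin 6, ((confPCoef4 (confSlot4 i ρ) m : ℤ) : ℤ[X]) * (if ρ' = confPairMem4 i m then 1 else 0)

/-- The reduced matrix (columns read through their codes). -/
noncomputable def confRedMatrix4 : Matrix (BlockIdx i 4) (BlockIdx i 4) ℤ[X] :=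
  Matrix.of fun ρ ρ' => confRed4 κ i ρ (windowStart i + (finSigmaFinEquiv ρ' : ℕ))

/-- The quotient matrix. -/
noncomputable def confQuotMatrix4 : Matrix (BlockIdx i 4) (BlockIdx i 4) ℤ[X] :=
  Matrix.of fun ρ ρ' => confQuot4 κ i ρ (windowStart i + (finSigmaFinEquiv ρ' : ℕ))

/-- **`U · J^κ(i,4)(Λ_conf)` is the reduced matrix.** -/
theorem confU4_mul_blockMatrix : confU4 i * blockMatrix κ i 4 confPoint4 = confRedMatrix4 κ i := by
  apply Matrix.ext
  intro ρ ρ'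
  by_cases hq : (ρ.2 : ℕ) < i
  · have key : (confU4 i * blockMatrix κ i 4 confPoint4) ρ ρ' =
        ∑ k : Fin 4, confACoef4 (ρ.2 : ℕ) (ρ.1 : ℕ) k * blockMatrix κ i 4 confPoint4 (confAttMem4 i k ρ hq) ρ' := by
      rw [Matrix.mul_apply]
      simp only [confU4, Matrix.of_apply, dif_pos hq, Finset.sum_mul, mul_assoc, ite_mul, one_mul, zero_mul]
      rw [Finset.sum_comm]
      refine Finset.sum_congr rfl fun k _ => ?_
      rw [← Finset.mul_sum, Finset.sum_ite_eq' Finset.univ (confAttMem4 i k ρ hq), if_pos (Finset.mem_univ _)]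
    rw [key, confRedMatrix4, Matrix.of_apply, confRed4, dif_pos hq]
    rfl
  · have key : (confU4 i * blockMatrix κ i 4 confPoint4) ρ ρ' =
        ∑ m : Fin 6, ((confPCoef4 (confSlot4 i ρ) m : ℤ) : ℤ[X]) * blockMatrix κ i 4 confPoint4 (confPairMem4 i m) ρ' := by
      rw [Matrix.mul_apply]
      simp only [confU4, Matrix.of_apply, dif_neg hq, Finset.sum_mul, mul_assoc, ite_mul, one_mul, zero_mul]
      rw [Finset.sum_comm]
      refine Finset.sum_congr rfl fun m _ => ?_
      rw [← Finset.mul_sum, Finset.sum_ite_eq' Finset.univ (confPairMem4 i m), if_pos (Finset.mem_univ _)]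
    rw [key, confRedMatrix4, Matrix.of_apply, confRed4, dif_neg hq]
    rfl

/-- **The reduced matrix is `diag(X^{pos}) ·` the quotient matrix.** -/
theorem confRedMatrix4_eq :
    confRedMatrix4 κ i = Matrix.diagonal (fun ρ => (X : ℤ[X]) ^ confPos4 i ρ) * confQuotMatrix4 κ i := by
  apply Matrix.ext
  intro ρ ρ'
  rw [Matrix.diagonal_mul, confRedMatrix4, confQuotMatrix4, Matrix.of_apply, Matrix.of_apply, confRed4_eq_X_pow_mul]

/-- **The constant-term matrix of the quotient matrix is `C₄`.** -/
theorem confQuotMatrix4_map_constantCoeff :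
    (Polynomial.constantCoeff : ℤ[X] →+* ℤ).mapMatrix (confQuotMatrix4 κ i) = confMatrix4 κ i := by
  apply Matrix.ext
  intro ρ ρ'
  rw [RingHom.mapMatrix_apply, Matrix.map_apply, confQuotMatrix4, confMatrix4, Matrix.of_apply, Matrix.of_apply,
    Polynomial.constantCoeff_apply, coeff_zero_confQuot4]

/-- **THE CONFLUENT QUADRUPLE CRITERION (point form).** -/
theorem det_blockMatrix_confPoint4_ne_zero (hC : (confMatrix4 κ i).det ≠ 0) : (blockMatrix κ i 4 confPoint4).det ≠ 0 := by
  intro hJ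
  have h1 : (confU4 i * blockMatrix κ i 4 confPoint4).det = 0 := by rw [Matrix.det_mul, hJ, mul_zero]
  rw [confU4_mul_blockMatrix, confRedMatrix4_eq, Matrix.det_mul, Matrix.det_diagonal] at h1
  rcases mul_eq_zero.mp h1 with h | h
  · exact absurd h (Finset.prod_ne_zero_iff.mpr fun ρ _ => pow_ne_zero _ X_ne_zero)
  · apply hC
    have e := RingHom.map_det (Polynomial.constantCoeff : ℤ[X] →+* ℤ) (confQuotMatrix4 κ i)
    rw [h, map_zero, confQuotMatrix4_map_constantCoeff] at e
    exact e.symm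

/-- **THE CONFLUENT QUADRUPLE CRITERION (symbolic form).**  `det C₄^κ(i) ≠ 0 ⇒ det J^κ(i,4)(Λ) ≠ 0` in `ℤ[Λ_0,…,Λ_3]`. -/
theorem det_blockMatrix_four_X_ne_zero_of_confluent (hC : (confMatrix4 κ i).det ≠ 0) :
    (blockMatrix κ i 4 (fun s : Fin 4 => (MvPolynomial.X s : MvPolynomial (Fin 4) ℤ))).det ≠ 0 :=
  det_blockMatrix_X_ne_zero_of_point κ i 4 confPoint4 (det_blockMatrix_confPoint4_ne_zero κ i hC)

end Assembly4

/-! ## 44. The nodes «CONFLUENT B4» / «B4» and the quadruple tiling -/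

/-- **CONJECTURE «CONFLUENT B4»** (memo g31 §2, typed): for EVERY `i ≥ 1` the λ-free integer confluent quadruple matrix
`C₄^{!}(i)` is nonsingular.  Unrestricted (no reference to THEOREM W's bad stages). -/
def Stmt.conjConfluentB4 : Prop := ∀ i : ℕ, 1 ≤ i → (confMatrix4 Nat.factorial i).det ≠ 0

/-- **CONJECTURE B4**: every tied quadruple block of the segment-weighted hierarchical Moore peel is nonsingular,
`det J^{!}(i,4)(Λ) ≠ 0` in `ℤ[Λ]` for every `i ≥ 1`. -/
def Stmt.conjB4 : Prop :=
  ∀ i : ℕ, 1 ≤ i → (blockMatrix Nat.factorial i 4 (fun s : Fin 4 => (MvPolynomial.X s : MvPolynomial (Fin 4) ℤ))).det ≠ 0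

/-- «Confluent B4» implies B4. -/
theorem conjB4_of_conjConfluentB4 (h : Stmt.conjConfluentB4) : Stmt.conjB4 :=
  fun i hi => det_blockMatrix_four_X_ne_zero_of_confluent Nat.factorial i (h i hi)

/-- **THE QUADRUPLE TILING**: under B4, `KernelPoisedAt k! h` for EVERY `h` — `h % 4` leading singles (stages `≤ 3 ≤ 182`,
good by THEOREM W's window) followed by `h / 4` quadruples. -/
theorem kernelPoisedAt_factorial_of_conjB4 (hB4 : Stmt.conjB4) (h : ℕ) : KernelPoisedAt Nat.factorial h := by
  set s₀ := h % 4 with hs₀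
  set a : ℕ → ℕ := fun q => if q ≤ s₀ then 1 + q else 1 + s₀ + 4 * (q - s₀) with ha
  have hs₀lt : s₀ < 4 := Nat.mod_lt h (by norm_num)
  have hdecomp : 4 * (h / 4) + s₀ = h := Nat.div_add_mod h 4
  refine kernelPoisedAt_of_blocks Nat.factorial (fun k => Nat.factorial_ne_zero k) h (s₀ + h / 4) a
    (by simp [ha]) ?_ ?_ ?_
  · simp only [ha]
    split_ifs with hle
    · have : h / 4 = 0 := by omega
      omega
    · omega
  · intro q hq
    simp only [ha]
    split_ifs <;> omega
  · intro q hq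
    by_cases hqs : q < s₀
    · have e1 : a (q + 1) - a q = 1 := by simp only [ha]; split_ifs <;> omega
      have e2 : a q = 1 + q := by simp only [ha]; rw [if_pos (le_of_lt hqs)]
      rw [e2] at e1 ⊢
      exact det_blockMatrix_X_ne_zero_of_eq Nat.factorial (1 + q) e1
        (det_blockMatrix_factorial_one_ne_zero_of_le_182 (1 + q) (by omega) (by omega))
    · have e1 : a (q + 1) - a q = 4 := by simp only [ha]; split_ifs <;> omega
      exact det_blockMatrix_X_ne_zero_of_eq Nat.factorial (a q) e1
        (hB4 (a q) (by simp only [ha]; split_ifs <;> omega))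

/-- **THE ARROW TO NODE #1, verbatim**: under B4 the line file's `SegmentMeanValueAt h` holds for EVERY `h`. -/
theorem segmentMeanValue_of_conjB4 (hB4 : Stmt.conjB4) (h : ℕ) :
    ∀ (r : ℕ) (u : Fin r → Finset (Fin h)), Function.Injective u → (∀ i, (u i).card ≤ 2) →
      (∀ S : Finset (Fin h), S.card ≤ 2 → ∃ i, u i = S) →
      ∃ P : Fin h → Fin h → ℂ,
        (Matrix.of fun i j : Fin r =>
          ∑ g : (↥(benchCols h r j) → ↥(u i)), (∏ c : ↥(benchCols h r j), P (g c) c) *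
            ∏ a : ↥(u i),
              ((Finset.univ.filter fun c : ↥(benchCols h r j) => g c = a).card.factorial : ℂ)).det ≠ 0 :=
  kernelPoisedAt_factorial_of_conjB4 hB4 h

/-- **THE ARROW «CONFLUENT B4 ⇒ node #1», verbatim.** -/
theorem segmentMeanValue_of_conjConfluentB4 (h4 : Stmt.conjConfluentB4) (h : ℕ) :
    ∀ (r : ℕ) (u : Fin r → Finset (Fin h)), Function.Injective u → (∀ i, (u i).card ≤ 2) →
      (∀ S : Finset (Fin h), S.card ≤ 2 → ∃ i, u i = S) →
      ∃ P : Fin h → Fin h → ℂ,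
        (Matrix.of fun i j : Fin r =>
          ∑ g : (↥(benchCols h r j) → ↥(u i)), (∏ c : ↥(benchCols h r j), P (g c) c) *
            ∏ a : ↥(u i),
              ((Finset.univ.filter fun c : ↥(benchCols h r j) => g c = a).card.factorial : ℂ)).det ≠ 0 :=
  segmentMeanValue_of_conjB4 (conjB4_of_conjConfluentB4 h4) h

end Summit.ValiantsHypothesis.ValiantsHypothesis.Theorems.BarrierLever.MoorePeel
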